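import Literature.MathematicalPhysics.QuantumManyBody.OneCoordinateMarginal
import Literature.MathematicalPhysics.QuantumManyBody.BoseGasProductState
import HarnessLib

/-!
# One-coordinate marginals: permutation symmetry and near-wall integrals

For a bosonic trial state `Φ` in the Dirichlet box `Λ_L^N`:

* `setLIntegral_energyDensity_coord_eq`, `setLIntegral_normSq_coord_eq` : the energy / mass in a
  half-space `{x_{j,a} > c}` does not depend on the particle label `j` (permutation symmetry);
* `setLIntegral_energyDensity_eq_ofReal` : `∫_{x_p > L - c} e_Φ = ∫₀ᶜ e(L - s) ds` with the real
  slice energy `e = sliceEnergyReal`;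
* `setLIntegral_normSq_eq_ofReal` : the same for the mass and the marginal `m = marginalMassReal`.

[folklore]
-/

noncomputable section

namespace Literature.MathematicalPhysics.QuantumManyBody.BoseGas

open _root_.MeasureTheory Filter Set Function
open scoped ENNReal NNReal Topology

variable {N : ℕ}
section Symmetry

variable {L : ℝ}

/-- The energy density of a Bose-symmetric state is relabelling invariant. [folklore] -/
theorem energyDensity_comp_perm (v : ℝ → ℝ≥0∞) (Φ : TrialState N L) (σ : Equiv.Perm (Fin N))
    (X : Config N) :
    kineticDensity Φ.ψ (X ∘ σ) + interaction v (X ∘ σ) * (‖Φ.ψ (X ∘ σ)‖₊ : ℝ≥0∞) ^ 2 =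
      kineticDensity Φ.ψ X + interaction v X * (‖Φ.ψ X‖₊ : ℝ≥0∞) ^ 2 := by
  have h1 : kineticDensity Φ.ψ (X ∘ σ) = kineticDensity Φ.ψ X := by
    rw [← kineticDensity_comp_perm σ (Φ.contDiff.differentiable one_ne_zero) X]
    congr 1
    funext Y
    exact Φ.symm σ Y
  rw [h1, interaction_comp_perm, Φ.symm σ X]

/-- **Per-particle near-wall energies are all equal** (Bose symmetry + relabelling invariance of
Lebesgue measure): `∫_{x_{j,a} > c} e_Φ = ∫_{x_{0,a} > c} e_Φ`. [folklore] -/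
theorem setLIntegral_energyDensity_coord_eq (v : ℝ → ℝ≥0∞) (hv : Measurable v) (Φ : TrialState N L)
    (j i : Fin N) (a : Fin 3) (c : ℝ) :
    ∫⁻ X in {X : Config N | c < X j a},
        (kineticDensity Φ.ψ X + interaction v X * (‖Φ.ψ X‖₊ : ℝ≥0∞) ^ 2) =
      ∫⁻ X in {X : Config N | c < X i a},
        (kineticDensity Φ.ψ X + interaction v X * (‖Φ.ψ X‖₊ : ℝ≥0∞) ^ 2) := by
  set σ : Equiv.Perm (Fin N) := Equiv.swap i j with hσ
  have hmeas : Measurable fun X : Config N =>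
      kineticDensity Φ.ψ X + interaction v X * (‖Φ.ψ X‖₊ : ℝ≥0∞) ^ 2 :=
    measurable_energyDensity hv Φ.contDiff.continuous
  have hset : ∀ k : Fin N, MeasurableSet {X : Config N | c < X k a} := fun k =>
    measurableSet_lt measurable_const (measurable_coord' (k, a))
  rw [← lintegral_indicator (hset j), ← lintegral_indicator (hset i),
    ← lintegral_comp_perm σ (({X : Config N | c < X i a}).indicator fun X =>
      kineticDensity Φ.ψ X + interaction v X * (‖Φ.ψ X‖₊ : ℝ≥0∞) ^ 2)]
  refine lintegral_congr fun X => ?_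
  simp only [Set.indicator, Set.mem_setOf_eq, Function.comp_apply]
  have hji : σ i = j := by rw [hσ, Equiv.swap_apply_left]
  rw [hji, energyDensity_comp_perm]

/-- The same for the mass: `∫_{x_{j,a} > c} |Φ|² = ∫_{x_{0,a} > c} |Φ|²`. [folklore] -/
theorem setLIntegral_normSq_coord_eq (Φ : TrialState N L) (j i : Fin N) (a : Fin 3) (c : ℝ) :
    ∫⁻ X in {X : Config N | c < X j a}, (‖Φ.ψ X‖₊ : ℝ≥0∞) ^ 2 =
      ∫⁻ X in {X : Config N | c < X i a}, (‖Φ.ψ X‖₊ : ℝ≥0∞) ^ 2 := by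
  set σ : Equiv.Perm (Fin N) := Equiv.swap i j with hσ
  have hset : ∀ k : Fin N, MeasurableSet {X : Config N | c < X k a} := fun k =>
    measurableSet_lt measurable_const (measurable_coord' (k, a))
  rw [← lintegral_indicator (hset j), ← lintegral_indicator (hset i),
    ← lintegral_comp_perm σ (({X : Config N | c < X i a}).indicator fun X =>
      (‖Φ.ψ X‖₊ : ℝ≥0∞) ^ 2)]
  refine lintegral_congr fun X => ?_
  simp only [Set.indicator, Set.mem_setOf_eq, Function.comp_apply]
  have hji : σ i = j := by rw [hσ, Equiv.swap_apply_left]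
  rw [hji, Φ.symm σ X]

end Symmetry

section NearWall

variable {L : ℝ}

/-- Off the box (coordinate `t ∉ (0,L)`) the whole slice is outside `Λ_L^N`. [folklore] -/
theorem sliceMap_not_mem_boxN (p : Fin N × Fin 3) {t : ℝ} (ht : t ∉ Set.Ioo 0 L)
    (y : SliceIdx N p → ℝ) : sliceMap p (t, y) ∉ boxN N L := by
  intro h
  have := h p.1 p.2
  rw [sliceMap_apply_same] at this
  exact ht this

/-- The slice energy vanishes off the box. [folklore] -/
theorem sliceEnergy_eq_zero_of_not_mem (v : ℝ → ℝ≥0∞) (Φ : TrialState N L) (p : Fin N × Fin 3)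
    {t : ℝ} (ht : t ∉ Set.Ioo 0 L) : sliceEnergy v Φ.ψ p t = 0 := by
  rw [sliceEnergy]
  have h : ∀ y : SliceIdx N p → ℝ, kineticDensity Φ.ψ (sliceMap p (t, y)) +
      interaction v (sliceMap p (t, y)) * (‖Φ.ψ (sliceMap p (t, y))‖₊ : ℝ≥0∞) ^ 2 = 0 := by
    intro y
    have hX := sliceMap_not_mem_boxN (L := L) p ht y
    have h0 : Φ.ψ (sliceMap p (t, y)) = 0 := Φ.eq_zero _ hX
    have h1 : fderiv ℝ Φ.ψ (sliceMap p (t, y)) = 0 := Φ.fderiv_eq_zero hX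
    simp [kineticDensity, h0, h1]
  simp_rw [h]
  exact lintegral_zero

/-- Measurability of the slice energy in `t`. [folklore] -/
theorem measurable_sliceEnergy {v : ℝ → ℝ≥0∞} (hv : Measurable v) (Φ : TrialState N L)
    (p : Fin N × Fin 3) : Measurable (sliceEnergy v Φ.ψ p) := by
  have hF : Measurable fun z : ℝ × (SliceIdx N p → ℝ) => kineticDensity Φ.ψ (sliceMap p z) +
      interaction v (sliceMap p z) * (‖Φ.ψ (sliceMap p z)‖₊ : ℝ≥0∞) ^ 2 :=
    (measurable_energyDensity hv Φ.contDiff.continuous).comp (measurePreserving_sliceMap p).measurable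
  exact hF.lintegral_prod_right'

/-- The slice energies integrate to the energy. [folklore] -/
theorem lintegral_sliceEnergy {v : ℝ → ℝ≥0∞} (hv : Measurable v) (Φ : TrialState N L)
    (p : Fin N × Fin 3) : ∫⁻ t, sliceEnergy v Φ.ψ p t = energy v Φ := by
  rw [energy, lintegral_eq_lintegral_slice p (measurable_energyDensity hv Φ.contDiff.continuous)]
  rfl

/-- **Near-wall energy as an interval integral of the slice energy** (wall coordinate `s = L - t`):
`∫_{x_p > L-c} e_Φ dX = ∫₀ᶜ e(L - s) ds` for a finite-energy state, `0 ≤ c`. [folklore] -/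
theorem setLIntegral_energyDensity_eq_ofReal {v : ℝ → ℝ≥0∞} (hv : Measurable v) (Φ : TrialState N L)
    (hE : energy v Φ ≠ ⊤) (p : Fin N × Fin 3) {c : ℝ} (hc : 0 ≤ c) :
    ∫⁻ X in {X : Config N | L - c < X p.1 p.2},
        (kineticDensity Φ.ψ X + interaction v X * (‖Φ.ψ X‖₊ : ℝ≥0∞) ^ 2) =
      ENNReal.ofReal (∫ s in (0 : ℝ)..c, sliceEnergyReal v Φ.ψ p (L - s)) := by
  have hdm := measurable_energyDensity hv Φ.contDiff.continuous
  have hset : MeasurableSet {X : Config N | L - c < X p.1 p.2} :=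
    measurableSet_lt measurable_const (measurable_coord' p)
  -- Step 1: near-wall set integral = `∫⁻ t in Ioi (L-c), sliceEnergy t`
  have h1 : ∫⁻ X in {X : Config N | L - c < X p.1 p.2},
      (kineticDensity Φ.ψ X + interaction v X * (‖Φ.ψ X‖₊ : ℝ≥0∞) ^ 2) =
      ∫⁻ t in Set.Ioi (L - c), sliceEnergy v Φ.ψ p t := by
    rw [← lintegral_indicator hset, ← lintegral_indicator measurableSet_Ioi]
    have hind : ∀ X : Config N, ({X : Config N | L - c < X p.1 p.2}).indicator
        (fun X => kineticDensity Φ.ψ X + interaction v X * (‖Φ.ψ X‖₊ : ℝ≥0∞) ^ 2) X =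
        (Set.Ioi (L - c)).indicator (fun _ => (1 : ℝ≥0∞)) (X p.1 p.2) *
          (kineticDensity Φ.ψ X + interaction v X * (‖Φ.ψ X‖₊ : ℝ≥0∞) ^ 2) := by
      intro X
      by_cases hX : L - c < X p.1 p.2
      · rw [Set.indicator_of_mem (show X ∈ {X : Config N | L - c < X p.1 p.2} from hX),
          Set.indicator_of_mem (show X p.1 p.2 ∈ Set.Ioi (L - c) from hX), one_mul]
      · rw [Set.indicator_of_notMem (show X ∉ {X : Config N | L - c < X p.1 p.2} from hX),
          Set.indicator_of_notMem (show X p.1 p.2 ∉ Set.Ioi (L - c) from hX), zero_mul]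
    simp_rw [hind]
    rw [lintegral_weight_mul_eq_slice p ((measurable_const.indicator measurableSet_Ioi)) hdm]
    refine lintegral_congr fun t => ?_
    by_cases ht : t ∈ Set.Ioi (L - c)
    · rw [Set.indicator_of_mem ht, Set.indicator_of_mem ht, one_mul]; rfl
    · rw [Set.indicator_of_notMem ht, Set.indicator_of_notMem ht, zero_mul]
  -- Step 2: nothing beyond `L`
  have h2 : ∫⁻ t in Set.Ioi (L - c), sliceEnergy v Φ.ψ p t = ∫⁻ t in Set.Ioc (L - c) L, sliceEnergy v Φ.ψ p t := by
    rw [← Set.Ioc_union_Ioi_eq_Ioi (show L - c ≤ L by linarith), lintegral_union measurableSet_Ioi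
      (Set.Ioc_disjoint_Ioi le_rfl)]
    have : ∫⁻ t in Set.Ioi L, sliceEnergy v Φ.ψ p t = 0 := by
      refine (setLIntegral_congr_fun measurableSet_Ioi (fun t ht => ?_)).trans lintegral_zero
      exact sliceEnergy_eq_zero_of_not_mem v Φ p (fun h => not_lt.2 (le_of_lt ht) h.2 |>.elim)
    rw [this, add_zero]
  -- Step 3: to a real interval integral
  have hfin : ∫⁻ t in Set.Ioc (L - c) L, sliceEnergy v Φ.ψ p t ≠ ⊤ := by
    refine ne_top_of_le_ne_top hE ?_
    rw [← lintegral_sliceEnergy hv Φ p]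
    exact setLIntegral_le_lintegral _ _
  have hmeas := measurable_sliceEnergy hv Φ p
  have hae : ∀ᵐ t ∂(volume.restrict (Set.Ioc (L - c) L)), sliceEnergy v Φ.ψ p t < ⊤ :=
    ae_lt_top hmeas hfin
  have h3 : ∫⁻ t in Set.Ioc (L - c) L, sliceEnergy v Φ.ψ p t =
      ENNReal.ofReal (∫ t in Set.Ioc (L - c) L, (sliceEnergy v Φ.ψ p t).toReal) := by
    rw [integral_toReal hmeas.aemeasurable hae, ENNReal.ofReal_toReal hfin]
  -- Step 4: `(sliceEnergy t).toReal = sliceEnergyReal t` for a.e. `t`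
  have h4 : ∀ᵐ t ∂(volume.restrict (Set.Ioc (L - c) L)),
      (sliceEnergy v Φ.ψ p t).toReal = sliceEnergyReal v Φ.ψ p t := by
    filter_upwards [hae] with t ht
    rw [sliceEnergyReal, sliceEnergy, integral_toReal]
    · exact ((hdm.comp ((measurePreserving_sliceMap p).measurable.comp
        (measurable_const.prodMk measurable_id))).aemeasurable)
    · exact ae_lt_top (hdm.comp ((measurePreserving_sliceMap p).measurable.comp
        (measurable_const.prodMk measurable_id))) ht.ne
  rw [h1, h2, h3, integral_congr_ae h4]
  -- Step 5: substitution `s = L - t`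
  congr 1
  rw [← intervalIntegral.integral_of_le (show L - c ≤ L by linarith)]
  have := intervalIntegral.integral_comp_sub_left (fun t => sliceEnergyReal v Φ.ψ p t) L (a := 0) (b := c)
  rw [this]
  simp

/-- Measurability of the marginal mass in `t`. [folklore] -/
theorem measurable_marginalMass (Φ : TrialState N L) (p : Fin N × Fin 3) :
    Measurable (marginalMass Φ.ψ p) := by
  have hF : Measurable fun z : ℝ × (SliceIdx N p → ℝ) => (‖Φ.ψ (sliceMap p z)‖₊ : ℝ≥0∞) ^ 2 :=
    ((Φ.contDiff.continuous.measurable.comp (measurePreserving_sliceMap p).measurable).nnnorm.coe_nnreal_ennreal).pow_const 2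
  exact hF.lintegral_prod_right'

/-- The marginal mass vanishes off the box. [folklore] -/
theorem marginalMass_eq_zero_of_not_mem (Φ : TrialState N L) (p : Fin N × Fin 3)
    {t : ℝ} (ht : t ∉ Set.Ioo 0 L) : marginalMass Φ.ψ p t = 0 := by
  rw [marginalMass]
  have h : ∀ y : SliceIdx N p → ℝ, (‖Φ.ψ (sliceMap p (t, y))‖₊ : ℝ≥0∞) ^ 2 = 0 := fun y => by
    simp [Φ.eq_zero _ (sliceMap_not_mem_boxN (L := L) p ht y)]
  simp_rw [h]
  exact lintegral_zero

/-- `(marginalMass t).toReal = marginalMassReal t`. [folklore] -/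
theorem toReal_marginalMass (Φ : TrialState N L) (p : Fin N × Fin 3) (t : ℝ) :
    (marginalMass Φ.ψ p t).toReal = marginalMassReal Φ.ψ p t := by
  rw [marginalMassReal, marginalMass, integral_eq_lintegral_of_nonneg_ae
    (Filter.Eventually.of_forall fun y => by positivity)]
  · congr 1
    refine lintegral_congr fun y => ?_
    rw [ENNReal.ofReal_pow (norm_nonneg _), ← enorm_eq_nnnorm, ← ofReal_norm]
  · exact ((Φ.contDiff.continuous.norm.measurable.comp ((measurePreserving_sliceMap p).measurable.comp
      (measurable_const.prodMk measurable_id))).pow_const 2).aestronglyMeasurable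

/-- **Near-wall mass as an interval integral of the marginal** (wall coordinate `s = L - t`):
`∫_{x_p > L-c} |Φ|² dX = ∫₀ᶜ m(L - s) ds`, `0 ≤ c`. [folklore] -/
theorem setLIntegral_normSq_eq_ofReal (Φ : TrialState N L) (p : Fin N × Fin 3) {c : ℝ} (hc : 0 ≤ c) :
    ∫⁻ X in {X : Config N | L - c < X p.1 p.2}, (‖Φ.ψ X‖₊ : ℝ≥0∞) ^ 2 =
      ENNReal.ofReal (∫ s in (0 : ℝ)..c, marginalMassReal Φ.ψ p (L - s)) := by
  have hdm : Measurable fun X : Config N => (‖Φ.ψ X‖₊ : ℝ≥0∞) ^ 2 :=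
    (Φ.contDiff.continuous.measurable.nnnorm.coe_nnreal_ennreal).pow_const 2
  have hset : MeasurableSet {X : Config N | L - c < X p.1 p.2} :=
    measurableSet_lt measurable_const (measurable_coord' p)
  have h1 : ∫⁻ X in {X : Config N | L - c < X p.1 p.2}, (‖Φ.ψ X‖₊ : ℝ≥0∞) ^ 2 =
      ∫⁻ t in Set.Ioi (L - c), marginalMass Φ.ψ p t := by
    rw [← lintegral_indicator hset, ← lintegral_indicator measurableSet_Ioi]
    have hind : ∀ X : Config N, ({X : Config N | L - c < X p.1 p.2}).indicator
        (fun X => (‖Φ.ψ X‖₊ : ℝ≥0∞) ^ 2) X =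
        (Set.Ioi (L - c)).indicator (fun _ => (1 : ℝ≥0∞)) (X p.1 p.2) * (‖Φ.ψ X‖₊ : ℝ≥0∞) ^ 2 := by
      intro X
      by_cases hX : L - c < X p.1 p.2
      · rw [Set.indicator_of_mem (show X ∈ {X : Config N | L - c < X p.1 p.2} from hX),
          Set.indicator_of_mem (show X p.1 p.2 ∈ Set.Ioi (L - c) from hX), one_mul]
      · rw [Set.indicator_of_notMem (show X ∉ {X : Config N | L - c < X p.1 p.2} from hX),
          Set.indicator_of_notMem (show X p.1 p.2 ∉ Set.Ioi (L - c) from hX), zero_mul]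
    simp_rw [hind]
    rw [lintegral_weight_mul_eq_slice p ((measurable_const.indicator measurableSet_Ioi)) hdm]
    refine lintegral_congr fun t => ?_
    by_cases ht : t ∈ Set.Ioi (L - c)
    · rw [Set.indicator_of_mem ht, Set.indicator_of_mem ht, one_mul]; rfl
    · rw [Set.indicator_of_notMem ht, Set.indicator_of_notMem ht, zero_mul]
  have h2 : ∫⁻ t in Set.Ioi (L - c), marginalMass Φ.ψ p t = ∫⁻ t in Set.Ioc (L - c) L, marginalMass Φ.ψ p t := by
    rw [← Set.Ioc_union_Ioi_eq_Ioi (show L - c ≤ L by linarith), lintegral_union measurableSet_Ioi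
      (Set.Ioc_disjoint_Ioi le_rfl)]
    have : ∫⁻ t in Set.Ioi L, marginalMass Φ.ψ p t = 0 := by
      refine (setLIntegral_congr_fun measurableSet_Ioi (fun t ht => ?_)).trans lintegral_zero
      exact marginalMass_eq_zero_of_not_mem Φ p (fun h => not_lt.2 (le_of_lt ht) h.2 |>.elim)
    rw [this, add_zero]
  have hfin : ∫⁻ t in Set.Ioc (L - c) L, marginalMass Φ.ψ p t ≠ ⊤ := by
    refine ne_top_of_le_ne_top (b := ∫⁻ t, marginalMass Φ.ψ p t) ?_ (setLIntegral_le_lintegral _ _)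
    rw [lintegral_marginalMass Φ.ψ Φ.contDiff.continuous.measurable p, Φ.norm_eq]
    exact ENNReal.one_ne_top
  have hmeas := measurable_marginalMass Φ p
  have hae : ∀ᵐ t ∂(volume.restrict (Set.Ioc (L - c) L)), marginalMass Φ.ψ p t < ⊤ :=
    ae_lt_top hmeas hfin
  have h3 : ∫⁻ t in Set.Ioc (L - c) L, marginalMass Φ.ψ p t =
      ENNReal.ofReal (∫ t in Set.Ioc (L - c) L, (marginalMass Φ.ψ p t).toReal) := by
    rw [integral_toReal hmeas.aemeasurable hae, ENNReal.ofReal_toReal hfin]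
  rw [h1, h2, h3]
  simp_rw [toReal_marginalMass]
  congr 1
  rw [← intervalIntegral.integral_of_le (show L - c ≤ L by linarith)]
  have := intervalIntegral.integral_comp_sub_left (fun t => marginalMassReal Φ.ψ p t) L (a := 0) (b := c)
  rw [this]
  simp

end NearWall
end Literature.MathematicalPhysics.QuantumManyBody.BoseGas

end
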